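import Summits.KontsevichZagierPeriods.KontsevichZagierPeriods.Theorems.SoloBlindPieces
import Summits.KontsevichZagierPeriods.KontsevichZagierPeriods.Theorems.SoloBlindGaps
import Literature.NumberTheory.Transcendental.KZCalculusOver
import Mathlib.RingTheory.EuclideanDomain
import Mathlib.Algebra.Polynomial.FieldDivision
import HarnessLib

/-!
# The Kontsevich–Zagier conjecture in dimension `≤ 1`, VIIb: every rational one-dimensional
representation is a cell sum

`isCellSum_of_isRational_one`: for every rational `r : IntegralRep 1`, `[r]` is congruent modulo
the Kontsevich–Zagier moves to a cell sum `K(α) + Σ L(cᵢ; λᵢ) + Σ A(dₖ; τₖ)`.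

Proof.  By `KZ.exists_sub_sum_bounded_mem_relations` we may assume the domain bounded.  Write the
domain as `line A`; `A ⊆ ℝ` is `ℚ`-semialgebraic, so its frontier is a finite set of algebraic
numbers (`SemialgebraicMonotonicity.exists_finset_Ioo_subset_or_disjoint`,
`isAlgebraic_of_mem_frontier`).  Let `E = frontier A ∪ {±N}` with `A ⊆ (−N, N)`.  Up to the null
set `line E`, the domain is the disjoint union of the closed gap intervals `[c, c']` of `E` with
`(c, c') ⊆ A` (rule (1), `KZ.of_sub_sum_of_mem_relations`).  Write the integrand as `P/Q` with
`P, Q ∈ ℚ[X]` coprime; since a rational one-dimensional representation with bounded domain has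
bounded integrand (`KZ.exists_bound_of_isRational_one`), `Q` does not vanish at the gap
endpoints, hence on a neighbourhood `(a, b) ⊃ [c, c']` with rational `a, b`; translating by a
rational point of `(a, b)` (rule (2)) puts us in the situation of `isCellSum_lineRep_ratFunc`.
-/

noncomputable section

open MeasureTheory Set Filter
open scoped BigOperators Topology Polynomial
open Literature.NumberTheory.Transcendental
open Literature.NumberTheory.Transcendental.KZ
open Literature.ModelTheory.ExponentialFields (IsSemialgebraic)

namespace Summit.KontsevichZagierPeriods.KontsevichZagierPeriods.Theorems

namespace SoloBlind

/-! ### Univariate readings of one-variable polynomials -/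

/-- A polynomial in the single variable `X 0` is a univariate polynomial in `x 0`. -/
theorem exists_ratPoly_aeval_eq (p : MvPolynomial (Fin 1) ℚ) :
    ∃ P : ℚ[X], ∀ x : Fin 1 → ℝ, MvPolynomial.aeval x p = Polynomial.aeval (x 0) P := by
  refine ⟨MvPolynomial.aeval (fun _ : Fin 1 => (Polynomial.X : ℚ[X])) p, fun x => ?_⟩
  rw [← AlgHom.comp_apply, MvPolynomial.comp_aeval]
  simp only [Polynomial.aeval_X]
  exact congrArg (fun y => MvPolynomial.aeval y p) (KZ.eq_const_apply_zero x)

/-- A quotient of univariate `ℚ`-polynomials with non-vanishing denominator is a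
`ℚ`-semialgebraic function on a semialgebraic line set. -/
theorem isSemialgebraicFunOn_aeval_div (P Q : ℚ[X]) {S : Set ℝ} (hS : IsSemialgebraic ℚ (line S))
    (hQ : ∀ t ∈ S, (Polynomial.aeval t Q : ℝ) ≠ 0) :
    IsSemialgebraicFunOn ℚ (line S)
      (fun x => Polynomial.aeval (x 0) P / Polynomial.aeval (x 0) Q) := by
  have hconv : ∀ (R : ℚ[X]) (x : Fin 1 → ℝ),
      MvPolynomial.aeval x (Polynomial.aeval (MvPolynomial.X 0 : MvPolynomial (Fin 1) ℚ) R) =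
        Polynomial.aeval (x 0) R := fun R x => by
    rw [← Polynomial.aeval_algHom_apply, MvPolynomial.aeval_X]
  have h := isSemialgebraicFunOn_aeval_div_aeval hS
    (Polynomial.aeval (MvPolynomial.X 0 : MvPolynomial (Fin 1) ℚ) P)
    (Polynomial.aeval (MvPolynomial.X 0 : MvPolynomial (Fin 1) ℚ) Q)
    (fun x hx => by rw [hconv]; exact hQ _ hx)
  exact h.congr fun x _ => by simp only [hconv]

/-- `P/Q` is continuous on a set where `Q` does not vanish. -/
theorem continuousOn_aeval_div (P Q : ℚ[X]) {S : Set ℝ}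
    (hQ : ∀ t ∈ S, (Polynomial.aeval t Q : ℝ) ≠ 0) :
    ContinuousOn (fun t : ℝ => (Polynomial.aeval t P : ℝ) / Polynomial.aeval t Q) S :=
  (Polynomial.continuous_aeval P).continuousOn.div (Polynomial.continuous_aeval Q).continuousOn hQ

/-! ### Pieces in general position -/

/-- A compact rational piece `[u, v] ⊂ (a, b)` with algebraic endpoints and denominator
non-vanishing on `(a, b)` is a cell sum: translate by a rational point of `(a, b)` (rule (2)) and
apply `isCellSum_lineRep_ratFunc`. -/
theorem isCellSum_lineRep_ratFunc_gen (P Q : ℚ[X]) {a b u v : ℝ} (haa : IsAlgebraic ℚ a)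
    (hba : IsAlgebraic ℚ b) (hau : a < u) (hvb : v < b) (huv : u ≤ v) (hu : IsAlgebraic ℚ u)
    (hv : IsAlgebraic ℚ v) (hQ : ∀ x ∈ Ioo a b, (Polynomial.aeval x Q : ℝ) ≠ 0)
    {hS : IsSemialgebraic ℚ (line (Icc u v))}
    {hf : IsSemialgebraicFunOn ℚ (line (Icc u v))
      (fun x => Polynomial.aeval (x 0) P / Polynomial.aeval (x 0) Q)}
    {hi : IntegrableOn (fun x : ℝ => (Polynomial.aeval x P : ℝ) / Polynomial.aeval x Q) (Icc u v)} :
    IsCellSum (of (lineRep (Icc u v)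
      (fun x : ℝ => (Polynomial.aeval x P : ℝ) / Polynomial.aeval x Q) hS hf hi)) := by
  obtain ⟨x₀, hax₀, hx₀b⟩ := exists_rat_btwn (hau.trans_le (huv.trans (hvb.le)))
  have hx₀ : IsAlgebraic ℚ ((x₀ : ℚ) : ℝ) := isAlgebraic_algebraMap x₀
  -- translated data
  set P' : ℚ[X] := P.comp (Polynomial.X + Polynomial.C x₀) with hP'
  set Q' : ℚ[X] := Q.comp (Polynomial.X + Polynomial.C x₀) with hQ'
  have hshift : ∀ (R : ℚ[X]) (t : ℝ),
      (Polynomial.aeval t (R.comp (Polynomial.X + Polynomial.C x₀)) : ℝ) =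
        Polynomial.aeval (t + x₀) R := fun R t => by
    rw [Polynomial.aeval_comp]
    simp only [map_add, Polynomial.aeval_X, Polynomial.aeval_C, eq_ratCast]
  have hQ'ne : ∀ x ∈ Ioo (a - x₀) (b - x₀), (Polynomial.aeval x Q' : ℝ) ≠ 0 := by
    intro x hx
    rw [hQ', hshift]
    exact hQ _ ⟨by linarith [hx.1], by linarith [hx.2]⟩
  have hQ'I : ∀ t ∈ Icc (u - x₀) (v - x₀), (Polynomial.aeval t Q' : ℝ) ≠ 0 := fun t ht =>
    hQ'ne t ⟨by linarith [ht.1], by linarith [ht.2]⟩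
  have hS₁ : IsSemialgebraic ℚ (line (Icc (u - x₀) (v - x₀))) :=
    isSemialgebraic_line_Icc (hu.sub hx₀) (hv.sub hx₀)
  have hg := isSemialgebraicFunOn_aeval_div P' Q' hS₁ hQ'I
  have hi₁ : IntegrableOn (fun t : ℝ => (Polynomial.aeval t P' : ℝ) / Polynomial.aeval t Q')
      (Icc (u - x₀) (v - x₀)) :=
    (continuousOn_aeval_div P' Q' hQ'I).integrableOn_compact isCompact_Icc
  have hcell : IsCellSum (of (lineRep (Icc (u - x₀) (v - x₀))
      (fun t : ℝ => (Polynomial.aeval t P' : ℝ) / Polynomial.aeval t Q') hS₁ hg hi₁)) :=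
    isCellSum_lineRep_ratFunc P' Q' (a := a - x₀) (b := b - x₀) (by linarith) (by linarith)
      (haa.sub hx₀) (hba.sub hx₀) (by linarith) (by linarith) (by linarith) (hu.sub hx₀)
      (hv.sub hx₀) hQ'ne
  refine hcell.of_sub_mem ?_
  refine lineRep_subst (fun t => t - x₀) (fun _ => 1) ?_ ?_ ?_ ?_ ?_
  · exact (isSemialgebraicFunOn_apply hS 0).fun_sub (isSemialgebraicFunOn_const_of_isAlgebraic hS hx₀)
  · intro t _
    exact ((hasDerivAt_id' t).sub_const (x₀ : ℝ)).hasDerivWithinAt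
  · intro s _ t _ h
    simpa using h
  · exact (image_Icc_of_monotoneOn huv (continuous_id.sub continuous_const).continuousOn
      (fun a _ b _ hab => sub_le_sub_right hab _)).symm
  · intro t _
    simp only [hP', hQ', hshift, sub_add_cancel, abs_one, mul_one]

/-! ### The reduced fraction does not vanish at gap endpoints -/

/-- If `P, Q` are coprime and `|P| ≤ M |Q|` on `(c, c')`, then `Q` has no zero on `[c, c']`. -/
theorem aeval_ne_zero_of_isCoprime_of_bound {P Q : ℚ[X]} (hcop : IsCoprime P Q) {M c c' : ℝ}
    (hcc' : c < c') (hbd : ∀ t ∈ Ioo c c', |(Polynomial.aeval t P : ℝ)| ≤ M * |Polynomial.aeval t Q|) :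
    ∀ t ∈ Icc c c', (Polynomial.aeval t Q : ℝ) ≠ 0 := by
  have hclosed : IsClosed {t : ℝ | |(Polynomial.aeval t P : ℝ)| ≤ M * |Polynomial.aeval t Q|} :=
    isClosed_le (continuous_abs.comp (Polynomial.continuous_aeval P))
      (continuous_const.mul (continuous_abs.comp (Polynomial.continuous_aeval Q)))
  have hIcc : Icc c c' ⊆ {t : ℝ | |(Polynomial.aeval t P : ℝ)| ≤ M * |Polynomial.aeval t Q|} := by
    rw [← closure_Ioo hcc'.ne]
    exact closure_minimal hbd hclosed
  intro t ht hQt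
  have hPt : (Polynomial.aeval t P : ℝ) = 0 := by
    have h := hIcc ht
    rw [mem_setOf_eq, hQt, abs_zero, mul_zero] at h
    exact abs_eq_zero.1 (le_antisymm h (abs_nonneg _))
  obtain ⟨a, b, hab⟩ := hcop
  have h := congrArg (Polynomial.aeval t : ℚ[X] → ℝ) hab
  simp only [map_add, map_mul, map_one, hPt, hQt, mul_zero, add_zero] at h
  exact zero_ne_one h

/-- A polynomial without zeros on `[c, c']` has no zeros on a rational neighbourhood `(a, b)`. -/
theorem exists_rat_Ioo_aeval_ne_zero (Q : ℚ[X]) {c c' : ℝ} (hcc' : c ≤ c')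
    (hQ : ∀ t ∈ Icc c c', (Polynomial.aeval t Q : ℝ) ≠ 0) :
    ∃ a b : ℚ, (a : ℝ) < c ∧ c' < b ∧ ∀ t ∈ Ioo (a : ℝ) b, (Polynomial.aeval t Q : ℝ) ≠ 0 := by
  have hcont : Continuous fun x : ℝ => (Polynomial.aeval x Q : ℝ) := Polynomial.continuous_aeval Q
  obtain ⟨ε, hε, hεc⟩ := Metric.eventually_nhds_iff.1
    (hcont.continuousAt.eventually_ne (hQ c ⟨le_rfl, hcc'⟩))
  obtain ⟨ε', hε', hεc'⟩ := Metric.eventually_nhds_iff.1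
    (hcont.continuousAt.eventually_ne (hQ c' ⟨hcc', le_rfl⟩))
  obtain ⟨a, hca, hac⟩ := exists_rat_btwn (show c - ε < c by linarith)
  obtain ⟨b, hcb, hbc⟩ := exists_rat_btwn (show c' < c' + ε' by linarith)
  refine ⟨a, b, hac, hcb, fun t ht => ?_⟩
  by_cases htc : t < c
  · exact hεc (by rw [Real.dist_eq, abs_sub_comm, abs_of_pos (by linarith)]; linarith [ht.1])
  by_cases htc' : c' < t
  · exact hεc' (by rw [Real.dist_eq, abs_of_pos (by linarith)]; linarith [ht.2])
  · exact hQ t ⟨not_lt.1 htc, not_lt.1 htc'⟩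

/-! ### Line sets: frontier and differences -/

/-- `line` commutes with set difference. -/
theorem line_diff (S T : Set ℝ) : line (S \ T) = line S \ line T := rfl

/-- A boundary point of `A ⊆ ℝ` gives a boundary point of `line A`. -/
theorem const_mem_frontier_line {A : Set ℝ} {t : ℝ} (ht : t ∈ frontier A) :
    (fun _ : Fin 1 => t) ∈ frontier (line A) := by
  have h := (Homeomorph.funUnique (Fin 1) ℝ).preimage_frontier A
  have hline : (Homeomorph.funUnique (Fin 1) ℝ) ⁻¹' A = line A := rfl
  rw [hline] at h
  rw [← h]
  exact ht

/-! ### The bounded case -/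

/-- **Normal form, bounded case.** A rational one-dimensional representation with bounded domain
is a cell sum. -/
theorem isCellSum_of_isRational_of_isBounded (r : IntegralRep 1) (hr : r.IsRational)
    (hb : Bornology.IsBounded r.domain) : IsCellSum (of r) := by
  classical
  -- the trace of the domain on the line
  obtain ⟨A, hA⟩ : ∃ A : Set ℝ, A = {t | (fun _ : Fin 1 => t) ∈ r.domain} := ⟨_, rfl⟩
  have hmemA : ∀ t : ℝ, t ∈ A ↔ (fun _ : Fin 1 => t) ∈ r.domain := fun t => by
    rw [hA, mem_setOf_eq]
  have hDA : r.domain = line A := by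
    ext x
    rw [mem_line, hmemA, ← KZ.eq_const_apply_zero x]
  -- the integrand as a reduced fraction `P₁/Q₁`
  obtain ⟨p, q, hq, hpq⟩ := hr
  obtain ⟨M, hM⟩ := KZ.exists_bound_of_isRational_one r ⟨p, q, hq, hpq⟩ hb
  obtain ⟨P₀, hP₀⟩ := exists_ratPoly_aeval_eq p
  obtain ⟨Q₀, hQ₀⟩ := exists_ratPoly_aeval_eq q
  have hQ₀A : ∀ t ∈ A, (Polynomial.aeval t Q₀ : ℝ) ≠ 0 := fun t ht => by
    have h := hq _ ((hmemA t).1 ht)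
    rwa [hQ₀] at h
  -- empty trace: the representation is null
  rcases Set.eq_empty_or_nonempty A with hAe | ⟨t₀, ht₀⟩
  · refine isCellSum_of_mem_relations (KZ.of_mem_relations_of_volume_eq_zero r ?_)
    rw [hDA, hAe, volume_line, measure_empty]
  have hQ₀0 : Q₀ ≠ 0 := fun h => hQ₀A t₀ ht₀ (by rw [h, map_zero])
  have hG0 : GCDMonoid.gcd P₀ Q₀ ≠ 0 := fun h => hQ₀0 ((gcd_eq_zero_iff P₀ Q₀).1 h).2
  obtain ⟨G, hG⟩ : ∃ G, G = GCDMonoid.gcd P₀ Q₀ := ⟨_, rfl⟩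
  obtain ⟨P₁, hP₁⟩ : ∃ P₁, P₁ = P₀ / G := ⟨_, rfl⟩
  obtain ⟨Q₁, hQ₁⟩ : ∃ Q₁, Q₁ = Q₀ / G := ⟨_, rfl⟩
  have hcop : IsCoprime P₁ Q₁ := by
    rw [hP₁, hQ₁, hG]
    exact isCoprime_div_gcd_div_gcd hQ₀0
  have hPG : P₀ = G * P₁ := by
    rw [hP₁, hG]
    exact (EuclideanDomain.mul_div_cancel' hG0 (gcd_dvd_left P₀ Q₀)).symm
  have hQG : Q₀ = G * Q₁ := by
    rw [hQ₁, hG]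
    exact (EuclideanDomain.mul_div_cancel' hG0 (gcd_dvd_right P₀ Q₀)).symm
  -- on `A`: `Q₁ ≠ 0`, the integrand is `P₁/Q₁`, and `|P₁| ≤ M |Q₁|`
  have hQ₁A : ∀ t ∈ A, (Polynomial.aeval t Q₁ : ℝ) ≠ 0 := fun t ht h =>
    hQ₀A t ht (by rw [hQG, map_mul, h, mul_zero])
  have hGA : ∀ t ∈ A, (Polynomial.aeval t G : ℝ) ≠ 0 := fun t ht h =>
    hQ₀A t ht (by rw [hQG, map_mul, h, zero_mul])
  have hfrac : ∀ t ∈ A, (Polynomial.aeval t P₀ : ℝ) / Polynomial.aeval t Q₀ =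
      Polynomial.aeval t P₁ / Polynomial.aeval t Q₁ := fun t ht => by
    rw [hPG, hQG, map_mul, map_mul, mul_div_mul_left _ _ (hGA t ht)]
  have hintA : ∀ x ∈ r.domain, r.integrand x =
      Polynomial.aeval (x 0) P₁ / Polynomial.aeval (x 0) Q₁ := fun x hx => by
    rw [hpq hx]
    simp only [hP₀, hQ₀]
    exact hfrac _ (by rw [hDA, mem_line] at hx; exact hx)
  have hbd : ∀ t ∈ A, |(Polynomial.aeval t P₁ : ℝ)| ≤ M * |Polynomial.aeval t Q₁| := by
    intro t ht
    have h := hM _ ((hmemA t).1 ht)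
    rw [hintA _ ((hmemA t).1 ht)] at h
    change |(Polynomial.aeval t P₁ : ℝ) / Polynomial.aeval t Q₁| ≤ M at h
    rwa [abs_div, div_le_iff₀ (abs_pos.2 (hQ₁A t ht))] at h
  -- a bounding box `A ⊆ (-N, N)`
  obtain ⟨N, hN⟩ : ∃ N : ℕ, A ⊆ Ioo (-(N : ℝ)) N := by
    obtain ⟨R, hR⟩ := hb.subset_closedBall 0
    refine ⟨⌈R⌉₊ + 1, fun t ht => ?_⟩
    have h1 : ‖(fun _ : Fin 1 => t)‖ ≤ R := mem_closedBall_zero_iff.1 (hR ((hmemA t).1 ht))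
    have h2 : ‖t‖ ≤ R := (norm_le_pi_norm (fun _ : Fin 1 => t) 0).trans h1
    rw [Real.norm_eq_abs] at h2
    have h3 : R < (⌈R⌉₊ : ℝ) + 1 := (Nat.le_ceil R).trans_lt (lt_add_one _)
    push_cast
    exact ⟨by linarith [neg_abs_le t], by linarith [le_abs_self t]⟩
  -- the frontier of `A` is finite and algebraic
  have hsa : IsSemialgebraic ℚ (line A) := by rw [← hDA]; exact r.isSemialgebraic_domain
  have hsaR : IsSemialgebraic ℝ {z : Fin 1 → ℝ | z 0 ∈ A} := hsa.baseChange ℝ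
  obtain ⟨F, hF⟩ := SemialgebraicMonotonicity.exists_finset_Ioo_subset_or_disjoint hsaR
  have hfrontF : ∀ t ∈ frontier A, t ∈ F := by
    intro t ht
    by_contra htF
    obtain ⟨p', q', hpt, htq, hpq'⟩ :=
      Literature.ModelTheory.ExponentialFields.exists_Ioo_forall_notMem_of_notMem F htF
    rcases hF p' q' hpq' with h1 | h1
    · exact ht.2 (interior_mono h1 (by rw [interior_Ioo]; exact ⟨hpt, htq⟩))
    · exact Set.disjoint_left.1 (h1.symm.closure_left isOpen_Ioo) ht.1 ⟨hpt, htq⟩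
  obtain ⟨E, hE⟩ : ∃ E : Finset ℝ,
      E = insert (-(N : ℝ)) (insert (N : ℝ) (F.filter fun e => e ∈ frontier A)) := ⟨_, rfl⟩
  have hNE₁ : (-(N : ℝ)) ∈ E := by rw [hE]; exact Finset.mem_insert_self _ _
  have hNE₂ : (N : ℝ) ∈ E := by
    rw [hE]; exact Finset.mem_insert_of_mem (Finset.mem_insert_self _ _)
  have hfrontE : ∀ t ∈ frontier A, t ∈ E := fun t ht => by
    rw [hE]
    exact Finset.mem_insert_of_mem (Finset.mem_insert_of_mem
      (Finset.mem_filter.2 ⟨hfrontF t ht, ht⟩))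
  have hEalg : ∀ e ∈ E, IsAlgebraic ℚ e := by
    intro e he
    rw [hE, Finset.mem_insert, Finset.mem_insert, Finset.mem_filter] at he
    rcases he with h | h | h
    · rw [h]; exact (isAlgebraic_nat N).neg
    · rw [h]; exact isAlgebraic_nat N
    · exact isAlgebraic_of_mem_frontier hsa (const_mem_frontier_line h.2)
  -- the gap pieces
  obtain ⟨s, hs⟩ : ∃ s : Finset (ℝ × ℝ),
      s = (E ×ˢ E).filter (fun cc => IsGap E cc.1 cc.2 ∧ Ioo cc.1 cc.2 ⊆ A) := ⟨_, rfl⟩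
  have hmem : ∀ cc ∈ s, IsGap E cc.1 cc.2 ∧ Ioo cc.1 cc.2 ⊆ A := fun cc hcc => by
    rw [hs, Finset.mem_filter] at hcc
    exact hcc.2
  have hQI : ∀ cc ∈ s, ∀ t ∈ Icc cc.1 cc.2, (Polynomial.aeval t Q₁ : ℝ) ≠ 0 := fun cc hcc =>
    aeval_ne_zero_of_isCoprime_of_bound hcop (hmem cc hcc).1.2.2.1
      (fun t ht => hbd t ((hmem cc hcc).2 ht))
  have hSI : ∀ cc ∈ s, IsSemialgebraic ℚ (line (Icc cc.1 cc.2)) := fun cc hcc =>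
    isSemialgebraic_line_Icc (hEalg _ (hmem cc hcc).1.1) (hEalg _ (hmem cc hcc).1.2.1)
  set R : s → IntegralRep 1 := fun i =>
    lineRep (Icc i.1.1 i.1.2) (fun t : ℝ => (Polynomial.aeval t P₁ : ℝ) / Polynomial.aeval t Q₁)
      (hSI i.1 i.2) (isSemialgebraicFunOn_aeval_div P₁ Q₁ (hSI i.1 i.2) (hQI i.1 i.2))
      ((continuousOn_aeval_div P₁ Q₁ (hQI i.1 i.2)).integrableOn_compact isCompact_Icc) with hR
  have hRdom : ∀ i, (R i).domain = line (Icc i.1.1 i.1.2) := fun i => rfl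
  have hRint : ∀ i x, (R i).integrand x =
      Polynomial.aeval (x 0) P₁ / Polynomial.aeval (x 0) Q₁ := fun i x => rfl
  -- each piece is a cell sum
  have hpiece : ∀ i, IsCellSum (of (R i)) := by
    intro i
    obtain ⟨⟨hc, hc', hlt, -⟩, hsub⟩ := hmem i.1 i.2
    obtain ⟨a, b, hac, hcb, hab⟩ := exists_rat_Ioo_aeval_ne_zero Q₁ hlt.le (hQI i.1 i.2)
    exact isCellSum_lineRep_ratFunc_gen P₁ Q₁ (isAlgebraic_algebraMap a) (isAlgebraic_algebraMap b)
      hac hcb hlt.le (hEalg _ hc) (hEalg _ hc') hab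
  -- rule (1): `[r] ≡ Σ pieces`
  have hrel : of r - ∑ i, of (R i) ∈ relations := by
    refine KZ.of_sub_sum_of_mem_relations Finset.univ r R (fun i _ => ?_) (fun i _ => ?_) ?_ ?_
    · -- pieces inside the domain up to endpoints
      obtain ⟨⟨-, -, -, -⟩, hsub⟩ := hmem i.1 i.2
      rw [hRdom, hDA, ← line_diff, volume_line]
      refine measure_mono_null (fun t ht => ?_)
        (show volume ({i.1.1, i.1.2} : Set ℝ) = 0 by
          rw [Set.insert_eq]; exact measure_union_null (measure_singleton _) (measure_singleton _))
      rcases ht.1.1.eq_or_lt with h | h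
      · exact Or.inl h.symm
      rcases ht.1.2.eq_or_lt with h' | h'
      · exact Or.inr h'
      · exact absurd (hsub ⟨h, h'⟩) ht.2
    · -- integrands agree
      intro x hx
      rw [hRint, hintA x hx.2]
    · -- the pieces cover the domain up to `line E`
      refine measure_mono_null (fun x hx => ?_)
        (show volume (line (E : Set ℝ)) = 0 by rw [volume_line]; exact Finset.measure_zero E _)
      rw [mem_line]
      have hxA : x 0 ∈ A := by rw [hDA] at hx; exact hx.1
      by_contra hxE
      obtain ⟨c, c', hgap, hxI⟩ := exists_isGap_mem E hxE ⟨_, hNE₁, (hN hxA).1⟩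
        ⟨_, hNE₂, (hN hxA).2⟩
      have hnofront : ∀ y ∈ Ioo c c', y ∉ frontier A := fun y hy hyf =>
        hgap.2.2.2 y (hfrontE y hyf) hy
      have hsub : Ioo c c' ⊆ A := Ioo_subset_of_frontier_of_mem hnofront hxI hxA
      have hcs : (c, c') ∈ s := by
        rw [hs, Finset.mem_filter, Finset.mem_product]
        exact ⟨⟨hgap.1, hgap.2.1⟩, hgap, hsub⟩
      refine hx.2 (Set.mem_iUnion₂.2 ⟨⟨(c, c'), hcs⟩, Finset.mem_univ _, ?_⟩)
      rw [hRdom, mem_line]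
      exact Ioo_subset_Icc_self hxI
    · -- distinct pieces overlap in null sets
      intro i _ j _ hij
      rw [hRdom, hRdom, ← line_inter, volume_line]
      exact volume_Icc_inter_Icc_of_isGap (hmem i.1 i.2).1 (hmem j.1 j.2).1
        (fun h => hij (Subtype.ext h))
  exact (IsCellSum.sum Finset.univ (fun i => of (R i)) fun i _ => hpiece i).of_sub_mem hrel

/-! ### The general case -/

/-- **Normal form.** Every rational one-dimensional representation is a cell sum. -/
theorem isCellSum_of_isRational_one (r : IntegralRep 1) (hr : r.IsRational) : IsCellSum (of r) := by
  obtain ⟨R, hR, hrel⟩ := KZ.exists_sub_sum_bounded_mem_relations r hr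
  exact (IsCellSum.sum Finset.univ (fun T => of (R T))
    fun T _ => isCellSum_of_isRational_of_isBounded (R T) (hR T).1 (hR T).2).of_sub_mem hrel

end SoloBlind

end Summit.KontsevichZagierPeriods.KontsevichZagierPeriods.Theorems
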